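import Summits.Ventures.HodgeRepro2.T5SU11KernelAnalytic
import Summits.Ventures.HodgeRepro2.T5SU11KernelCompositionIteratedDerivative

/-!
# The composed kernels are real-analytic in the spectral parameter, with the Taylor series
`K_μ^{∘(n+1)} = Σ_k C(n+k, k) (μ − μ₂)^k K_{μ₂}^{∘(n+k+1)}`

The composed kernel `K_μ^{∘(n+1)}(t, s) = (G^I_{λ(μ)})ⁿ K_{λ(μ)}(·, s)(t)` is `(1/n!) ∂ⁿ_μ K_μ(t, s)` (row 580) and the kernel is
real-analytic in `μ` on `(−1, ∞)` (row 584), so the composed kernels are real-analytic there; their Taylor coefficients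
are the iterated derivatives of row 586 divided by the factorials, `(n+k)!/(n! k!) = C(n+k, k)`:

* `kernel_comp_analyticAt_mu`, `kernel_comp_analyticOnNhd_mu` — **`μ ↦ K_{λ(μ)}^{∘(n+1)}(t, s)` is real-analytic on `(−1, ∞)`**;
* `kernel_comp_hasFPowerSeriesAt` — **its power series at `μ₂` is `Σ_k C(n+k, k) K_{μ₂}^{∘(n+k+1)}(t, s) (μ − μ₂)^k`**
  (`FormalMultilinearSeries.ofScalars`);
* `kernel_comp_eventually_hasSum` — **`K_{μ₂+y}^{∘(n+1)}(t, s) = Σ_k C(n+k, k) K_{μ₂}^{∘(n+k+1)}(t, s) y^k` for all `y` near `0`**;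
* `kernel_comp_analyticAt_lam` — analytic in `λ` on `(1, ∞)` as well.

(The disc of convergence is not made explicit here; row 577 is the case `n = 0` with the sharp disc `|μ − μ₂| < (λ₂ − 1)²`.)
Nothing is claimed about (N).

Blind lane: Mathlib + the HodgeRepro2 prefix only; no sorry; axioms ⊆ {propext, Classical.choice,
Quot.sound}.
-/

namespace Summit.Ventures.HodgeRepro2.T5SU11KernelCompositionAnalytic

open Filter Topology MeasureTheory
open Set (Ioi Ioc)
open T5SU11Cartan T5SU11SphericalFunction T5SU11SphericalDecay T5SU11RadialGreenKernel T5SU11RadialGreenImproper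
  T5SU11ResolventDerivativeMu T5SU11KernelIteratedDerivative T5SU11KernelAnalytic
  T5SU11KernelCompositionIteratedDerivative

section measure

variable [MeasurableSpace Circle] [BorelSpace Circle]

variable {s : ℝ} (hs : 0 < s)

include hs in
/-- **The composed kernels are real-analytic in `μ`** at every `μ₂ > −1`: `K_μ^{∘(n+1)} = (1/n!) ∂ⁿ_μ K_μ` and the kernel is
analytic on `(−1, ∞)`. -/
theorem kernel_comp_analyticAt_mu (n : ℕ) {μ₂ : ℝ} (hμ₂ : -1 < μ₂) {t : ℝ} (ht : 0 < t) :
    AnalyticAt ℝ (fun μ => ((greenSolI (fun t => sph (1 + Real.sqrt (μ + 1)) (hyp t))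
      (sphDecay (1 + Real.sqrt (μ + 1))))^[n] (fun r => sphGreenKernel (1 + Real.sqrt (μ + 1)) r s)) t) μ₂ := by
  have hd := (kernel_analyticOnNhd_mu hs ht).iterated_deriv n
  have h1 : AnalyticAt ℝ (fun μ => (1 / (n.factorial : ℝ))
      * deriv^[n] (fun μ => sphGreenKernel (1 + Real.sqrt (μ + 1)) t s) μ) μ₂ :=
    analyticAt_const.mul (hd μ₂ hμ₂)
  refine h1.congr ?_
  filter_upwards [eventually_gt_nhds hμ₂] with μ hμ
  rw [← iteratedDeriv_eq_iterate, iteratedDeriv_kernel_mu hs n hμ ht]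
  have : (n.factorial : ℝ) ≠ 0 := by positivity
  field_simp

include hs in
/-- The composed kernels are real-analytic in `μ` on `(−1, ∞)`. -/
theorem kernel_comp_analyticOnNhd_mu (n : ℕ) {t : ℝ} (ht : 0 < t) :
    AnalyticOnNhd ℝ (fun μ => ((greenSolI (fun t => sph (1 + Real.sqrt (μ + 1)) (hyp t))
      (sphDecay (1 + Real.sqrt (μ + 1))))^[n] (fun r => sphGreenKernel (1 + Real.sqrt (μ + 1)) r s)) t) (Ioi (-1)) :=
  fun _ hμ => kernel_comp_analyticAt_mu hs n hμ ht

include hs in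
/-- **THE TAYLOR SERIES OF THE COMPOSED KERNELS**: at every `μ₂ > −1`, `μ ↦ K_{λ(μ)}^{∘(n+1)}(t, s)` has the power series
`Σ_k C(n+k, k) K_{λ(μ₂)}^{∘(n+k+1)}(t, s) (μ − μ₂)^k`. -/
theorem kernel_comp_hasFPowerSeriesAt (n : ℕ) {μ₂ : ℝ} (hμ₂ : -1 < μ₂) {t : ℝ} (ht : 0 < t) :
    HasFPowerSeriesAt (fun μ => ((greenSolI (fun t => sph (1 + Real.sqrt (μ + 1)) (hyp t))
        (sphDecay (1 + Real.sqrt (μ + 1))))^[n] (fun r => sphGreenKernel (1 + Real.sqrt (μ + 1)) r s)) t)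
      (FormalMultilinearSeries.ofScalars ℝ (fun k => ((n + k).choose k : ℝ)
        * ((greenSolI (fun t => sph (1 + Real.sqrt (μ₂ + 1)) (hyp t))
          (sphDecay (1 + Real.sqrt (μ₂ + 1))))^[n + k] (fun r => sphGreenKernel (1 + Real.sqrt (μ₂ + 1)) r s)) t))
      μ₂ := by
  have h := (kernel_comp_analyticAt_mu hs n hμ₂ ht).hasFPowerSeriesAt
  have hcoef : (fun k : ℕ => iteratedDeriv k (fun μ => ((greenSolI (fun t => sph (1 + Real.sqrt (μ + 1)) (hyp t))
        (sphDecay (1 + Real.sqrt (μ + 1))))^[n] (fun r => sphGreenKernel (1 + Real.sqrt (μ + 1)) r s)) t) μ₂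
        / (k.factorial : ℝ))
      = fun k => ((n + k).choose k : ℝ) * ((greenSolI (fun t => sph (1 + Real.sqrt (μ₂ + 1)) (hyp t))
          (sphDecay (1 + Real.sqrt (μ₂ + 1))))^[n + k] (fun r => sphGreenKernel (1 + Real.sqrt (μ₂ + 1)) r s)) t := by
    funext k
    rw [iteratedDeriv_kernel_comp_mu hs k n hμ₂ ht, Nat.descFactorial_eq_factorial_mul_choose]
    push_cast
    have : (k.factorial : ℝ) ≠ 0 := by positivity
    field_simp
  rw [hcoef] at h
  exact h

include hs in
/-- **The composed kernels are the sums of their Taylor series near every `μ₂ > −1`**: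
`K_{λ(μ₂+y)}^{∘(n+1)}(t, s) = Σ_k C(n+k, k) K_{λ(μ₂)}^{∘(n+k+1)}(t, s) y^k` for all `y` in a neighbourhood of `0`. -/
theorem kernel_comp_eventually_hasSum (n : ℕ) {μ₂ : ℝ} (hμ₂ : -1 < μ₂) {t : ℝ} (ht : 0 < t) :
    ∀ᶠ y : ℝ in 𝓝 0, HasSum (fun k : ℕ => ((n + k).choose k : ℝ)
        * ((greenSolI (fun t => sph (1 + Real.sqrt (μ₂ + 1)) (hyp t))
          (sphDecay (1 + Real.sqrt (μ₂ + 1))))^[n + k] (fun r => sphGreenKernel (1 + Real.sqrt (μ₂ + 1)) r s)) t * y ^ k)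
      (((greenSolI (fun t => sph (1 + Real.sqrt (μ₂ + y + 1)) (hyp t))
        (sphDecay (1 + Real.sqrt (μ₂ + y + 1))))^[n] (fun r => sphGreenKernel (1 + Real.sqrt (μ₂ + y + 1)) r s)) t) := by
  filter_upwards [(kernel_comp_hasFPowerSeriesAt hs n hμ₂ ht).eventually_hasSum] with y hy
  simpa only [FormalMultilinearSeries.ofScalars_apply_eq, smul_eq_mul] using hy

include hs in
/-- **The composed kernels are real-analytic in `λ`** at every `λ₂ > 1`. -/
theorem kernel_comp_analyticAt_lam (n : ℕ) {lam₂ : ℝ} (hlam₂ : 1 < lam₂) {t : ℝ} (ht : 0 < t) :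
    AnalyticAt ℝ (fun lam => ((greenSolI (fun t => sph lam (hyp t)) (sphDecay lam))^[n]
      (fun r => sphGreenKernel lam r s)) t) lam₂ := by
  have hμ : AnalyticAt ℝ (fun lam : ℝ => lam * (lam - 2)) lam₂ :=
    analyticAt_id.mul (analyticAt_id.sub analyticAt_const)
  have hμ₂ : -1 < lam₂ * (lam₂ - 2) := by nlinarith
  have h := (kernel_comp_analyticAt_mu hs n hμ₂ ht).comp_of_eq hμ rfl
  refine h.congr ?_
  filter_upwards [eventually_gt_nhds hlam₂] with lam hlam
  simp only [Function.comp]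
  rw [one_add_sqrt_eq hlam]

end measure

end Summit.Ventures.HodgeRepro2.T5SU11KernelCompositionAnalytic
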